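import Literature.NumberTheory.Automorphic.HeckeEulerFactorisationGL2DualKirillov
import Literature.NumberTheory.Automorphic.ArchKirillovMellinConvergenceGL2
import HarnessLib

/-!
# The standard `L`-theory of `GL₂` and Gelbart's Prop. 4.1 from the archimedean GAMMA IDENTITIES alone
# (Jacquet–Langlands (1970), Thm. 5.15, Thm. 6.4; proof of Thm. 11.1)

Topic `NumberTheory/Automorphic`; namespace `Literature.NumberTheory.Automorphic`. Theorems only (no
definition, no named fact, no instance). Companion to `HeckeEulerFactorisationGL2DualKirillov`: there the
named facts `JacquetLanglands1970_standardLTheoryGL2` (Jacquet–Langlands (1970), Thm. 11.1 / Cor. 11.2),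
`frobSatakeCompatibleAt_of_isPiOfArtinRep_of_isUnramifiedAt` (Gelbart (1997), Prop. 4.1 at the
`σ`-unramified places), `JacquetLanglands1970_twistedHeckeTheoryGL2` and
`frobSatakeCompatibleAt_of_isPiOfArtinRep` were derived from the Kirillov-only archimedean input
`(A_W)`: one `K_∞`-finite Gårding vector `e₀` of the archimedean component whose two Mellin transforms
`∫ W_{e₀}(diag(u,1)) N(u)^{s-1/2} d^×u`, `∫ ω(u⁻¹) W_{τ(w)e₀}(diag(u,1)) N(u)^{s-1/2} d^×u` are (i) absolutely
convergent on a right half-plane and (ii) reciprocals there of entire functions with zeros on finitely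
many horizontal lines. By `integrable_kirillovFn_mul_norm_cpow` (`ArchKirillovMellinConvergenceGL2`:
Jacquet–Langlands' Thm. 5.15 (i) / 6.4 (i) for ALL Gårding vectors, `re s ≥ 1`) clause (i) is automatic,
so the archimedean input shrinks to the GAMMA IDENTITIES (ii) alone — hypothesis `(A_Γ)` of

* `integralRepresentation_clean_of_archKirillovGamma` — the analytic package `(IR)` for clean
  `A_G`-invariant cuspidal data;
* `JacquetLanglands1970_standardLTheoryGL2_of_archKirillovGamma`,
  `frobSatakeCompatibleAt_of_isPiOfArtinRep_of_isUnramifiedAt_of_archKirillovGamma`,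
  `JacquetLanglands1970_twistedHeckeTheoryGL2_and_frobSatakeCompatibleAt_of_archKirillovGamma` — the
  four named facts from `(A_Γ)`.

On the way: `continuous_of_apply_glDiagonal_const_eq_smul` — the central character of a strongly
continuous representation on a non-trivial space is continuous.

## References

* H. Jacquet, R. P. Langlands, *Automorphic Forms on GL(2)*, LNM 114 (1970), Thm. 5.15, Thm. 6.4, Thm. 11.1,
  Cor. 11.2, proof of Thm. 11.1 (pp. 171–173 of the retypeset edition). [JacquetLanglands1970]
* S. Gelbart, *Three lectures on the modularity of `ρ̄_{E,3}` and the Langlands reciprocity conjecture*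
  (1997), Prop. 4.1. [Gelbart1997]
-/

noncomputable section

open MeasureTheory Measure NumberField NumberField.InfinitePlace NumberField.mixedEmbedding IsDedekindDomain Set Filter
open scoped MatrixGroups NNReal Topology Classical Polynomial

namespace Literature.NumberTheory.Automorphic

-- as in `ArchGardingWhittaker`
set_option backward.isDefEq.respectTransparency false

/-! ### 1. The central character is continuous -/

section Central

variable {K : Type} [Field K] [NumberField K] {hcpt : isCompact_glFiniteIntegralLevel 2 K}
  {E : Type*} [NormedAddCommGroup E] [InnerProductSpace ℂ E]
  {τ : ContRepresentation ℂ (AutomorphyDatum.gl 2 K hcpt).arch.carrier E}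

/-- **The central character of a strongly continuous representation is continuous**: if
`τ(c · 1) = ω(c)` on a non-trivial `E` (e.g. `τ` topologically irreducible), then
`ω(c) = ⟪v, τ(c·1) v⟫ / ⟪v, v⟫` for any `v ≠ 0`. [folklore] -/
theorem continuous_of_apply_glDiagonal_const_eq_smul (hτ : τ.IsStronglyContinuous) (hτi : τ.IsTopIrreducible)
    {ω : (mixedSpace K)ˣ → ℂ}
    (hω : ∀ (c : (mixedSpace K)ˣ) (v : E), τ (toArch hcpt (glDiagonal 2 (mixedSpace K) fun _ => c)) v = ω c • v) :
    Continuous ω := by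
  haveI : Nontrivial E := ((ContRepresentation.isTopIrreducible_iff τ).1 hτi).1
  obtain ⟨v, hv⟩ := exists_ne (0 : E)
  have hvv : (inner ℂ v v : ℂ) ≠ 0 := inner_self_ne_zero.2 hv
  have heq : ω = fun c => inner ℂ v (τ (toArch hcpt (glDiagonal 2 (mixedSpace K) fun _ => c)) v) / inner ℂ v v := by
    funext c
    rw [hω c v, inner_smul_right, mul_div_assoc, div_self hvv, mul_one]
  rw [heq]
  refine Continuous.div_const (Continuous.inner continuous_const ?_) _
  exact (hτ v).comp (((continuous_glDiagonal (n := 2) (mixedSpace K)).comp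
    (continuous_pi fun _ => continuous_id)).subtype_mk _)

end Central

/-! ### 2. `(A_Γ) ⇒ (A_W)`: the integrability clauses are automatic -/

section ArchGamma

/-- **The analytic package `(IR)` for clean `A_G`-invariant cuspidal data of `GL₂(𝔸_F)` from the
archimedean GAMMA IDENTITIES alone.** Hypothesis `(A_Γ)`: for the archimedean component `τ` of every
cuspidal `Π ≤ L²_cusp(GL₂)` (central character `ω` handed over), the transferred Whittaker functional `ℓ`
and any Haar measure of `K_∞ˣ`, ONE `K_∞`-finite Gårding `e₀` and entire `Γ_∞`, `Γ̃_∞` with zeros on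
finitely many horizontal lines such that, on a right half-plane,
`Γ_∞(s) ∫ W_{e₀}(diag(u,1)) N(u)^{s-1/2} d^×u = 1` and
`Γ̃_∞(s) ∫ ω(u⁻¹) W_{τ(w)e₀}(diag(u,1)) N(u)^{s-1/2} d^×u = 1` (Jacquet–Langlands' Thm. 5.15 (ii)–(iv) /
Thm. 6.4 for the test vector). The absolute convergence required by
`integralRepresentation_clean_of_archHeckeTestVectorMinW` is `integrable_kirillovFn_mul_norm_cpow`
(for `e₀` and for `τ(w) e₀`, on `re s ≥ 1`; `ω` is continuous of modulus `1`).
[cite: JacquetLanglands1970, Thm. 5.15, Thm. 6.4, proof of Thm. 11.1 (pp. 171–173)] -/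
theorem integralRepresentation_clean_of_archKirillovGamma
    (hA : ∀ (K : Type) [Field K] [NumberField K] (hcpt : isCompact_glFiniteIntegralLevel 2 K)
      (μ : Measure (AdelicGroupData.gl 2 K).automorphicQuotient) [(AdelicGroupData.gl 2 K).IsAutomorphicMeasure μ]
      (Pl : CuspidalAutomorphicRepGL 2 K μ)
      (E : Type) [NormedAddCommGroup E] [InnerProductSpace ℂ E] [CompleteSpace E]
      (τ : ContRepresentation ℂ (AutomorphyDatum.gl 2 K hcpt).arch.carrier E) (hτ : τ.IsStronglyContinuous)
      (_ : τ.IsUnitary) (_ : τ.IsTopIrreducible) (_ : ∃ T ∈ archIntertwiners hcpt τ Pl.1, T ≠ 0)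
      (ω : (mixedSpace K)ˣ → ℂ) (_ : ∀ c, ‖ω c‖ = 1)
      (_ : ∀ (c : (mixedSpace K)ˣ) (v : E), τ (toArch hcpt (glDiagonal 2 (mixedSpace K) fun _ => c)) v = ω c • v)
      (ℓ : archGardingSpace hcpt τ →ₗ[ℂ] ℂ) (_ : IsArchContWhittakerFunctional hcpt τ hτ ℓ) (_ : ℓ ≠ 0)
      [MeasurableSpace ((mixedSpace K)ˣ)] [BorelSpace ((mixedSpace K)ˣ)]
      (μ' : Measure ((mixedSpace K)ˣ)) (_ : IsHaarMeasure μ'),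
      ∃ (e₀ : archGardingSpace hcpt τ)
        (_ : FiniteDimensional ℂ (Submodule.span ℂ (Set.range
          fun κ : (AutomorphyDatum.gl 2 K hcpt).arch.maximalCompact =>
            τ (toArch hcpt (κ : GL (Fin 2) (mixedSpace K))) (e₀ : E))))
        (Γi Γi' : ℂ → ℂ) (_ : Differentiable ℂ Γi) (_ : Differentiable ℂ Γi')
        (_ : ∃ Y : Set ℝ, Y.Finite ∧ ∀ s, Γi s = 0 → s.im ∈ Y)
        (_ : ∃ Y : Set ℝ, Y.Finite ∧ ∀ s, Γi' s = 0 → s.im ∈ Y) (x₀ : ℝ),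
        ∀ s : ℂ, x₀ < s.re →
          Γi s * ∫ u : (mixedSpace K)ˣ, kirillovFn hτ ℓ e₀ u *
              ((mixedEmbedding.norm ((u : (mixedSpace K)ˣ) : mixedSpace K) : ℝ) : ℂ) ^ (s - 1 / 2) ∂μ' = 1 ∧
          Γi' s * ∫ u : (mixedSpace K)ˣ,
              ω u⁻¹ * kirillovFn hτ ℓ (gardingAct hτ (weylLong 2 (mixedSpace K)) e₀) u *
                ((mixedEmbedding.norm ((u : (mixedSpace K)ˣ) : mixedSpace K) : ℝ) : ℂ) ^ (s - 1 / 2) ∂μ' = 1)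
    {F : Type} [Field F] [NumberField F] (hcpt : isCompact_glFiniteIntegralLevel 2 F)
    (π : CuspidalAutomorphicRepData 2 F hcpt) (P P' : HeightOneSpectrum (𝓞 F) → ℂ[X])
    (hbot : π.1.W' = ⊥)
    (hAG : ∀ φ ∈ π.1.W, ∀ (t : ℝ≥0ˣ) (g : (AdelicGroupData.gl 2 F).Adelic),
      φ ((show (AdelicGroupData.gl 2 F).Adelic from posRealScalar 2 F t) * g) = φ g)
    (hP : ∀ (u : HeightOneSpectrum (𝓞 F)) (πu : SmoothIrrep (GL (Fin 2) (u.adicCompletion F))),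
      π.1.HasLocalComponentAt u πu.ρ →
      ∀ (ψ : AddChar (u.adicCompletion F) Circle), ψ.IsContinuousNontrivial →
      ∀ [MeasurableSpace (u.adicCompletion F)] [BorelSpace (u.adicCompletion F)]
        [MeasurableSpace (GL (Fin 1) (u.adicCompletion F) ⧸ upperUnitriangular (Fin 1) (u.adicCompletion F))]
        [BorelSpace (GL (Fin 1) (u.adicCompletion F) ⧸ upperUnitriangular (Fin 1) (u.adicCompletion F))]
        (ν : Measure (GL (Fin 1) (u.adicCompletion F) ⧸ upperUnitriangular (Fin 1) (u.adicCompletion F)))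
        [SMulInvariantMeasure (GL (Fin 1) (u.adicCompletion F))
          (GL (Fin 1) (u.adicCompletion F) ⧸ upperUnitriangular (Fin 1) (u.adicCompletion F)) ν]
        [IsFiniteMeasureOnCompacts ν] [ν.IsOpenPosMeasure],
        HasRSLFactor Nat.one_lt_two πu.ρ
          (Representation.trivial ℂ (GL (Fin 1) (u.adicCompletion F)) ℂ) ψ ν (P u))
    (hP' : ∀ (u : HeightOneSpectrum (𝓞 F)) (πu : SmoothIrrep (GL (Fin 2) (u.adicCompletion F))),
      π.transposeInv.1.HasLocalComponentAt u πu.ρ →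
      ∀ (ψ : AddChar (u.adicCompletion F) Circle), ψ.IsContinuousNontrivial →
      ∀ [MeasurableSpace (u.adicCompletion F)] [BorelSpace (u.adicCompletion F)]
        [MeasurableSpace (GL (Fin 1) (u.adicCompletion F) ⧸ upperUnitriangular (Fin 1) (u.adicCompletion F))]
        [BorelSpace (GL (Fin 1) (u.adicCompletion F) ⧸ upperUnitriangular (Fin 1) (u.adicCompletion F))]
        (ν : Measure (GL (Fin 1) (u.adicCompletion F) ⧸ upperUnitriangular (Fin 1) (u.adicCompletion F)))
        [SMulInvariantMeasure (GL (Fin 1) (u.adicCompletion F))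
          (GL (Fin 1) (u.adicCompletion F) ⧸ upperUnitriangular (Fin 1) (u.adicCompletion F)) ν]
        [IsFiniteMeasureOnCompacts ν] [ν.IsOpenPosMeasure],
        HasRSLFactor Nat.one_lt_two πu.ρ
          (Representation.trivial ℂ (GL (Fin 1) (u.adicCompletion F)) ℂ) ψ ν (P' u)) :
    ∃ (c₀ : ℝ) (Z Z' J J' Γ Γ' η : ℂ → ℂ),
      Differentiable ℂ Z ∧ Differentiable ℂ Z' ∧ Differentiable ℂ J ∧ Differentiable ℂ J' ∧
      Differentiable ℂ Γ ∧ Differentiable ℂ Γ' ∧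
      (∃ Y : Set ℝ, Y.Finite ∧ ∀ s, Γ s = 0 → s.im ∈ Y) ∧
      (∃ Y : Set ℝ, Y.Finite ∧ ∀ s, Γ' s = 0 → s.im ∈ Y) ∧
      (∀ s : ℂ, c₀ < s.re → J s ≠ 0 ∧ Z s * Γ s =
        J s * ∏' u : HeightOneSpectrum (𝓞 F), ((P u).eval ((u.residueCard : ℂ) ^ (-s)))⁻¹) ∧
      (∀ s : ℂ, c₀ < s.re → J' s ≠ 0 ∧ Z' s * Γ' s =
        J' s * ∏' u : HeightOneSpectrum (𝓞 F), ((P' u).eval ((u.residueCard : ℂ) ^ (-s)))⁻¹) ∧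
      (∀ s, Z s = Z' (1 - s)) ∧
      Continuous η ∧ (∀ s, η s ≠ 0) ∧ (∀ s, J' (1 - s) = η s * J s) := by
  refine integralRepresentation_clean_of_archHeckeTestVectorMinW ?_ hcpt π P P' hbot hAG hP hP'
  intro K _ _ hcptK μ _ Pl E _ _ _ τ hτ hτu hτi hex ω hω1 hω ℓ hℓ hℓ0 _ _ μ' hμ'
  haveI := hμ'
  obtain ⟨e₀, he₀, Γi, Γi', hΓi, hΓi', hY, hY', x₀, hI⟩ :=
    hA K hcptK μ Pl E τ hτ hτu hτi hex ω hω1 hω ℓ hℓ hℓ0 μ' hμ'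
  refine ⟨e₀, he₀, Γi, Γi', hΓi, hΓi', hY, hY', max x₀ 1, fun s hs => ?_⟩
  have hs₀ : x₀ < s.re := lt_of_le_of_lt (le_max_left _ _) hs
  have hs₁ : 1 ≤ s.re := ((le_max_right _ _).trans hs.le)
  refine ⟨⟨integrable_kirillovFn_mul_norm_cpow μ' hℓ hτu hτi e₀ hs₁, (hI s hs₀).1⟩, ?_, (hI s hs₀).2⟩
  -- the dual integrand: `ω(u⁻¹)` is continuous of modulus `1`, `τ(w) e₀` is a Gårding vector
  have h1 := integrable_kirillovFn_mul_norm_cpow μ' hℓ hτu hτi (gardingAct hτ (weylLong 2 (mixedSpace K)) e₀) hs₁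
  have hωc : Continuous ω := continuous_of_apply_glDiagonal_const_eq_smul hτ hτi hω
  refine (h1.bdd_mul (c := 1) ((hωc.comp continuous_inv).aestronglyMeasurable)
    (ae_of_all _ fun u => (hω1 u⁻¹).le)).congr (ae_of_all _ fun u => ?_)
  simp only [Function.comp_apply, mul_assoc]

/-- **Jacquet–Langlands (1970), Thm. 11.1 / Cor. 11.2 (the named fact `JacquetLanglands1970_standardLTheoryGL2`)
from the archimedean Gamma identities alone.** [cite: JacquetLanglands1970, Thm. 11.1, Cor. 11.2, Thm. 5.15, Thm. 6.4] -/
theorem JacquetLanglands1970_standardLTheoryGL2_of_archKirillovGamma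
    (hA : ∀ (K : Type) [Field K] [NumberField K] (hcpt : isCompact_glFiniteIntegralLevel 2 K)
      (μ : Measure (AdelicGroupData.gl 2 K).automorphicQuotient) [(AdelicGroupData.gl 2 K).IsAutomorphicMeasure μ]
      (Pl : CuspidalAutomorphicRepGL 2 K μ)
      (E : Type) [NormedAddCommGroup E] [InnerProductSpace ℂ E] [CompleteSpace E]
      (τ : ContRepresentation ℂ (AutomorphyDatum.gl 2 K hcpt).arch.carrier E) (hτ : τ.IsStronglyContinuous)
      (_ : τ.IsUnitary) (_ : τ.IsTopIrreducible) (_ : ∃ T ∈ archIntertwiners hcpt τ Pl.1, T ≠ 0)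
      (ω : (mixedSpace K)ˣ → ℂ) (_ : ∀ c, ‖ω c‖ = 1)
      (_ : ∀ (c : (mixedSpace K)ˣ) (v : E), τ (toArch hcpt (glDiagonal 2 (mixedSpace K) fun _ => c)) v = ω c • v)
      (ℓ : archGardingSpace hcpt τ →ₗ[ℂ] ℂ) (_ : IsArchContWhittakerFunctional hcpt τ hτ ℓ) (_ : ℓ ≠ 0)
      [MeasurableSpace ((mixedSpace K)ˣ)] [BorelSpace ((mixedSpace K)ˣ)]
      (μ' : Measure ((mixedSpace K)ˣ)) (_ : IsHaarMeasure μ'),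
      ∃ (e₀ : archGardingSpace hcpt τ)
        (_ : FiniteDimensional ℂ (Submodule.span ℂ (Set.range
          fun κ : (AutomorphyDatum.gl 2 K hcpt).arch.maximalCompact =>
            τ (toArch hcpt (κ : GL (Fin 2) (mixedSpace K))) (e₀ : E))))
        (Γi Γi' : ℂ → ℂ) (_ : Differentiable ℂ Γi) (_ : Differentiable ℂ Γi')
        (_ : ∃ Y : Set ℝ, Y.Finite ∧ ∀ s, Γi s = 0 → s.im ∈ Y)
        (_ : ∃ Y : Set ℝ, Y.Finite ∧ ∀ s, Γi' s = 0 → s.im ∈ Y) (x₀ : ℝ),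
        ∀ s : ℂ, x₀ < s.re →
          Γi s * ∫ u : (mixedSpace K)ˣ, kirillovFn hτ ℓ e₀ u *
              ((mixedEmbedding.norm ((u : (mixedSpace K)ˣ) : mixedSpace K) : ℝ) : ℂ) ^ (s - 1 / 2) ∂μ' = 1 ∧
          Γi' s * ∫ u : (mixedSpace K)ˣ,
              ω u⁻¹ * kirillovFn hτ ℓ (gardingAct hτ (weylLong 2 (mixedSpace K)) e₀) u *
                ((mixedEmbedding.norm ((u : (mixedSpace K)ˣ) : mixedSpace K) : ℝ) : ℂ) ^ (s - 1 / 2) ∂μ' = 1) :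
    JacquetLanglands1970_standardLTheoryGL2 :=
  JacquetLanglands1970_standardLTheoryGL2_of_integralRepresentation_clean
    fun hcpt π P P' hbot hAG hP hP' =>
      integralRepresentation_clean_of_archKirillovGamma hA hcpt π P P' hbot hAG hP hP'

/-- **Gelbart (1997), Prop. 4.1 at the σ-unramified places (the named fact
`frobSatakeCompatibleAt_of_isPiOfArtinRep_of_isUnramifiedAt`) from the archimedean Gamma identities alone.**
[cite: Gelbart1997, Prop. 4.1] [cite: JacquetLanglands1970, Thm. 12.2, Thm. 11.1, Thm. 5.15, Thm. 6.4] -/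
theorem frobSatakeCompatibleAt_of_isPiOfArtinRep_of_isUnramifiedAt_of_archKirillovGamma
    (hA : ∀ (K : Type) [Field K] [NumberField K] (hcpt : isCompact_glFiniteIntegralLevel 2 K)
      (μ : Measure (AdelicGroupData.gl 2 K).automorphicQuotient) [(AdelicGroupData.gl 2 K).IsAutomorphicMeasure μ]
      (Pl : CuspidalAutomorphicRepGL 2 K μ)
      (E : Type) [NormedAddCommGroup E] [InnerProductSpace ℂ E] [CompleteSpace E]
      (τ : ContRepresentation ℂ (AutomorphyDatum.gl 2 K hcpt).arch.carrier E) (hτ : τ.IsStronglyContinuous)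
      (_ : τ.IsUnitary) (_ : τ.IsTopIrreducible) (_ : ∃ T ∈ archIntertwiners hcpt τ Pl.1, T ≠ 0)
      (ω : (mixedSpace K)ˣ → ℂ) (_ : ∀ c, ‖ω c‖ = 1)
      (_ : ∀ (c : (mixedSpace K)ˣ) (v : E), τ (toArch hcpt (glDiagonal 2 (mixedSpace K) fun _ => c)) v = ω c • v)
      (ℓ : archGardingSpace hcpt τ →ₗ[ℂ] ℂ) (_ : IsArchContWhittakerFunctional hcpt τ hτ ℓ) (_ : ℓ ≠ 0)
      [MeasurableSpace ((mixedSpace K)ˣ)] [BorelSpace ((mixedSpace K)ˣ)]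
      (μ' : Measure ((mixedSpace K)ˣ)) (_ : IsHaarMeasure μ'),
      ∃ (e₀ : archGardingSpace hcpt τ)
        (_ : FiniteDimensional ℂ (Submodule.span ℂ (Set.range
          fun κ : (AutomorphyDatum.gl 2 K hcpt).arch.maximalCompact =>
            τ (toArch hcpt (κ : GL (Fin 2) (mixedSpace K))) (e₀ : E))))
        (Γi Γi' : ℂ → ℂ) (_ : Differentiable ℂ Γi) (_ : Differentiable ℂ Γi')
        (_ : ∃ Y : Set ℝ, Y.Finite ∧ ∀ s, Γi s = 0 → s.im ∈ Y)
        (_ : ∃ Y : Set ℝ, Y.Finite ∧ ∀ s, Γi' s = 0 → s.im ∈ Y) (x₀ : ℝ),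
        ∀ s : ℂ, x₀ < s.re →
          Γi s * ∫ u : (mixedSpace K)ˣ, kirillovFn hτ ℓ e₀ u *
              ((mixedEmbedding.norm ((u : (mixedSpace K)ˣ) : mixedSpace K) : ℝ) : ℂ) ^ (s - 1 / 2) ∂μ' = 1 ∧
          Γi' s * ∫ u : (mixedSpace K)ˣ,
              ω u⁻¹ * kirillovFn hτ ℓ (gardingAct hτ (weylLong 2 (mixedSpace K)) e₀) u *
                ((mixedEmbedding.norm ((u : (mixedSpace K)ˣ) : mixedSpace K) : ℝ) : ℂ) ^ (s - 1 / 2) ∂μ' = 1) :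
    frobSatakeCompatibleAt_of_isPiOfArtinRep_of_isUnramifiedAt :=
  frobSatakeCompatibleAt_of_isPiOfArtinRep_of_isUnramifiedAt_of_JacquetLanglands1970_standardLTheoryGL2
    (JacquetLanglands1970_standardLTheoryGL2_of_archKirillovGamma hA)

/-- The Galois-twisted Hecke theory `JacquetLanglands1970_twistedHeckeTheoryGL2` and the `π`-unramified
companion `frobSatakeCompatibleAt_of_isPiOfArtinRep` from the archimedean Gamma identities alone.
[cite: Gelbart1997, Prop. 4.1] [cite: JacquetLanglands1970, Thm. 11.1, Cor. 11.2, Thm. 5.15, Thm. 6.4] -/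
theorem JacquetLanglands1970_twistedHeckeTheoryGL2_and_frobSatakeCompatibleAt_of_archKirillovGamma
    (hA : ∀ (K : Type) [Field K] [NumberField K] (hcpt : isCompact_glFiniteIntegralLevel 2 K)
      (μ : Measure (AdelicGroupData.gl 2 K).automorphicQuotient) [(AdelicGroupData.gl 2 K).IsAutomorphicMeasure μ]
      (Pl : CuspidalAutomorphicRepGL 2 K μ)
      (E : Type) [NormedAddCommGroup E] [InnerProductSpace ℂ E] [CompleteSpace E]
      (τ : ContRepresentation ℂ (AutomorphyDatum.gl 2 K hcpt).arch.carrier E) (hτ : τ.IsStronglyContinuous)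
      (_ : τ.IsUnitary) (_ : τ.IsTopIrreducible) (_ : ∃ T ∈ archIntertwiners hcpt τ Pl.1, T ≠ 0)
      (ω : (mixedSpace K)ˣ → ℂ) (_ : ∀ c, ‖ω c‖ = 1)
      (_ : ∀ (c : (mixedSpace K)ˣ) (v : E), τ (toArch hcpt (glDiagonal 2 (mixedSpace K) fun _ => c)) v = ω c • v)
      (ℓ : archGardingSpace hcpt τ →ₗ[ℂ] ℂ) (_ : IsArchContWhittakerFunctional hcpt τ hτ ℓ) (_ : ℓ ≠ 0)
      [MeasurableSpace ((mixedSpace K)ˣ)] [BorelSpace ((mixedSpace K)ˣ)]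
      (μ' : Measure ((mixedSpace K)ˣ)) (_ : IsHaarMeasure μ'),
      ∃ (e₀ : archGardingSpace hcpt τ)
        (_ : FiniteDimensional ℂ (Submodule.span ℂ (Set.range
          fun κ : (AutomorphyDatum.gl 2 K hcpt).arch.maximalCompact =>
            τ (toArch hcpt (κ : GL (Fin 2) (mixedSpace K))) (e₀ : E))))
        (Γi Γi' : ℂ → ℂ) (_ : Differentiable ℂ Γi) (_ : Differentiable ℂ Γi')
        (_ : ∃ Y : Set ℝ, Y.Finite ∧ ∀ s, Γi s = 0 → s.im ∈ Y)
        (_ : ∃ Y : Set ℝ, Y.Finite ∧ ∀ s, Γi' s = 0 → s.im ∈ Y) (x₀ : ℝ),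
        ∀ s : ℂ, x₀ < s.re →
          Γi s * ∫ u : (mixedSpace K)ˣ, kirillovFn hτ ℓ e₀ u *
              ((mixedEmbedding.norm ((u : (mixedSpace K)ˣ) : mixedSpace K) : ℝ) : ℂ) ^ (s - 1 / 2) ∂μ' = 1 ∧
          Γi' s * ∫ u : (mixedSpace K)ˣ,
              ω u⁻¹ * kirillovFn hτ ℓ (gardingAct hτ (weylLong 2 (mixedSpace K)) e₀) u *
                ((mixedEmbedding.norm ((u : (mixedSpace K)ˣ) : mixedSpace K) : ℝ) : ℂ) ^ (s - 1 / 2) ∂μ' = 1) :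
    JacquetLanglands1970_twistedHeckeTheoryGL2 ∧ frobSatakeCompatibleAt_of_isPiOfArtinRep :=
  ⟨JacquetLanglands1970_twistedHeckeTheoryGL2_of_JacquetLanglands1970_standardLTheoryGL2
      (JacquetLanglands1970_standardLTheoryGL2_of_archKirillovGamma hA),
    frobSatakeCompatibleAt_of_isPiOfArtinRep_of_JacquetLanglands1970_standardLTheoryGL2
      (JacquetLanglands1970_standardLTheoryGL2_of_archKirillovGamma hA)⟩

end ArchGamma

end Literature.NumberTheory.Automorphic
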